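import Literature.NumberTheory.LFunctions.GreatestRealZeroElementaryProofs
import Literature.NumberTheory.LFunctions.DeuringZeroSpacingPhenomenon
import Literature.NumberTheory.LFunctions.MertensFormula
import Mathlib.Data.List.Permutation
import HarnessLib

/-!
# Pintz 1976 (II), Theorems 4 and 5 — `L(1, χ) ≤ 1/log²D` forces `χ(p) = −1` for most `p ≤ D²`,
# and `L(1)/δ ≪ (log D log log D/log(1/(5L(1) log D)))²` — PROVED

Topic `Literature/NumberTheory/LFunctions` (namespace `Literature.NumberTheory.LFunctions`, helpers in
`Pintz1976`). Second PROOF file for the statement file `GreatestRealZeroElementary.lean`, continuing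
`GreatestRealZeroElementaryProofs.lean` (Theorems 1 and 2, (3.5)–(3.6), (6.1) and the glue
`Pintz1976.theorem5_of_theorem4`). Discharged here:

* `pintz1976_theorem4_holds : pintz1976_theorem4` — J. Pintz, *Elementary methods in the theory of
  L-functions, II*, Acta Arith. **31** (1976) 273–289, Theorem 4 (pp. 277–278, (1.25)–(1.26)): "If for
  the real non-principal character `χ (mod D)` `L(1, χ) ≤ 1/log²D` then
  `exp(Σ_{p≤D²}(1 + χ(p))/p) ≪ (log D log log D/log(1/(5L(1,χ) log D)))²`";
* `pintz1976_theorem5_holds : pintz1976_theorem5` — Theorem 5 (pp. 278–279, (1.30)–(1.31)): under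
  the same hypothesis, for the Siegel zero `1 − δ`, `L(1)/δ ≪ (log D log log D/log(1/(5L(1) log D)))²`
  (from Theorem 4 by the PROVED glue `Pintz1976.theorem5_of_theorem4` of the first proof file).

Everything in this file is PROVED (theorems only; no definition, no named fact, no new hypothesis).

## Source and road (as printed, §5 pp. 286–288)

Source READ first-hand (journal scan `aa3139.pdf`, pp. 286–288 rendered by the typing seat
littype-FP2-2 g11 under `run/shared/lean/pub/parity-realchar/littype-FP2-2/scans-g11/`).

PRINT (Lemma 3, p. 286): "For a non-principal real character `χ (mod D)` (`≥ 1500`) for any `A`,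
`2 ≤ A ≤ D²`, and with the notation `Σ_{A<p≤D², χ(p)≠−1} 1/p = α` (5.1) the inequality
`L(1) > (1/(5 log D))(α log A/(8 log D))^{8 log D/log A}` (5.2) holds. Proof. Let us consider all the
intervals of the form `(A^{2^{i−1}}, A^{2^i}]` for `i = 1, 2, …, m`, where `m` is defined by
`C = A^{2^{m−1}} < D⁴ ≤ A^{2^m} = C²`. As here `A^{2^m} = C² < D⁸`, we have `2^m < 8 log D/log A`.
Then there exists an `i ≤ m` for which `Σ_{A^{2^{i−1}}<p≤A^{2^i}, χ(p)≠−1} 1/p ≥ α/m`. If we raise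
the two sides of this inequality to the power `2^{m−i}` then on the left side we shall get numbers
of the form `n^{−1}`, `n = ∏_{j=1}^{2^{m−i}} p_j` (`A^{2^{i−1}} < p ≤ A^{2^i}`; `χ(p) ≠ −1`) with a
multiplicity `≤ (2^{m−i})!`, so we have (since `α < m`)
`Σ_{C<n≤C², p∣n⇒χ(p)≠−1} 1/n ≥ (1/(2^{m−i})!)(α/m)^{2^{m−i}} > (α/2^m)^{2^m} > (α log A/(8 log D))^{8 log D/log A}`.
Considering that if for all `p` prime factors of `n` `χ(p) ≠ −1`, then `g(n) ≥ 1`, and that for an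
arbitrary `m`, `g(m) ≥ 0`, we get (5.3) `Σ_{C<n≤C²} g(n)/n > (α log A/(8 log D))^{8 log D/log A}`."
(p. 287) "But our Lemma 1 asserts for `x ≥ √D log²D` … Applying this with `x = C`, and `x = C²`,
we have as `D² ≤ C < D⁴`, `√D·L(1) ≥ π`, (5.4) `Σ_{C<n≤C²} g(n)/n = log C·L(1) + 10ϑ√(√D log D log D⁴/D²)
≤ 4 log D·L(1) + 20 log D/D^{3/4} < 5 log D·L(1)`. (5.4) and (5.3) together gives (5.2). To prove
Theorem 4 we need a result of Mertens, that for `x ≥ 3` (5.5) `Σ_{p≤x} 1/p ≤ log log x + B` …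
Let `A` be defined by (5.6) `log A = 8 log D log log D/log(1/(5 log D·L(1)))` (`≥ 8`) and let us
assume that the assertion of Theorem 4 (i.e. (1.26)) is not true but (5.7)
`exp(Σ_{p≤D²}(1+χ(p))/p) ≥ e^{2B+2} log²A`. Then (5.8) `Σ_{p≤D²}(1+χ(p))/p ≥ 2 log log A + 2B + 2`.
From (5.8) and (5.5) it follows that `A ≤ D²`, and (5.9) `Σ_{A<p≤D²}(1+χ(p))/p ≥ 2` and so (5.10)
`α = Σ_{A<p≤D², χ(p)≠−1} 1/p ≥ 1 ≥ 8/log A`." (p. 288) "Now using Lemma 3 from (5.2) we have (5.11)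
`5 log D·L(1) > (1/log D)^{8 log D/log A}`, (5.12) `(8 log D/log A) log log D > log(1/(5 log D·L(1)))`
which contradicts to (5.6) and so the Theorem 4 is proved." §6: Theorem 5 from Theorem 1, (6.1) and
Theorem 4 (first proof file, `theorem5_of_theorem4`).

HERE, in the same order (Part M):
* `card_filter_prod_eq_le_factorial`, `pow_sum_inv_le_factorial_mul_sum` — "multiplicity
  `≤ (2^{m−i})!`": `(Σ_{p∈P} 1/p)^k ≤ k!·Σ_n 1/n` over the products of `k` primes of `P`;
  `pow_lt_prod_le` (the products lie in `(C, C²]`), `one_le_g_of_forall_primeFactors` (`g(n) ≥ 1`);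
* `rpow_div_le_of_pow_le_factorial_mul` — the selection step: if `α ≤ Σ_{j<m} σ_j`,
  `σ_j^{2^j} ≤ (2^j)! U`, `0 ≤ α ≤ M`, `2^m ≤ M`, then `(α/M)^M ≤ U` (this replaces the printed
  "(since `α < m`)", which would need `Σ_{y<p≤y²} 1/p < 1` for every `y ≥ 2`; the hypothesis
  `α ≤ M` is supplied by Mertens' theorem where Theorem 4 uses the lemma);
* `lemma3_weak` — Lemma 3 in threshold form: `D ≥ 65536`, `χ` real primitive, `2 ≤ A ≤ D²`,
  `α ≤ 16 log D/log A` ⟹ `(α log A/(16 log D))^{16 log D/log A} ≤ 9 log D·L(1)`; here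
  `C = A^{2^{m−1}} ∈ [D⁴, D⁸)` so that the tree's substitute for Lemma 1 (Montgomery–Vaughan 11.2.3(g),
  `Pintz1976.sum_Ioc_g_div_le`, `Y = ⌊√N⌋`) has error `≤ 280(1 + log D) log D/D^{3/2} ≤ (log D − 1)L(1)`
  by `√D L(1) ≥ 2/3` (`two_thirds_le_sqrt_mul_lOne`, from the tree's class-number-formula bounds
  `sqrt_mul_norm_LFunction_one_ge_of_odd/_even`);
* `theorem4` — by contradiction as printed, with the tree's two-sided Mertens theorem
  `Mertens.abs_primeRecipSum_sub_le` (`|Σ_{p≤x} 1/p − log log x − B₁| ≤ 8/log x`, `B = B₁` the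
  Meissel–Mertens constant), `log A = 16 log D log log D/log(1/(9e log D·L(1)))`, the factor `e`
  replacing the strictness of (5.2) in (5.11)–(5.12); `C = 1024 e^{2B₁+3}`,
  `D₀ = max(D₃, 65536, ⌈e^{125}⌉)`.

READING NOTES: (viii) the printed Lemma 3 (`D ≥ 1500`, constant `5`, resting on Lemma 1 with the
printed constant `5`) is NOT discharged — `pintz1976_lemma3` stays a named fact; the threshold form
has weaker constants, which is immaterial for Theorems 4–5 (typed with `∃ C, D₀`); (ix) the
strictness of (5.2) used in (5.12) is replaced by the factor `e` in `log A`; (x) Mertens' `B` is the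
tree's `meisselMertens`. WHAT THIS IS NOT: no claim that a character with `L(1) ≤ 1/log²D` exists;
nothing here bears on parity; `pintz1976_theorem3`/`_schinzel`, `lemma1`, `lemma3` untouched.

## References

* [Pintz1976ElementaryII] J. Pintz, Acta Arith. 31 (1976) 273–289: Lemma 3 p. 286 (5.1)–(5.4),
  Theorem 4 pp. 277–278 (1.25)–(1.26), §5 (5.5)–(5.12) pp. 287–288; Theorem 5 pp. 278–279, §6 p. 288.
* [HardyWright2008] Thm 427 (Mertens' second theorem with rate; tree `MertensFormula.lean`).
* [MontgomeryVaughan2007] §11.2.1 Exercise 3(g) (tree `DirichletConvOneChiSum.lean`); Theorem 9.13 /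
  [NeukirchANT1999] VII (5.11) (class number formula bounds, tree `DeuringZeroSpacingPhenomenon.lean`).
-/

noncomputable section

open Complex Filter Topology Set MeasureTheory Finset ArithmeticFunction

namespace Literature.NumberTheory.LFunctions

namespace Pintz1976

open DirichletAbel RealChar
open scoped Nat

section Aux

/-- `log x ≤ 8 x^{1/8}` (`x ≥ 0`). [folklore] -/
private theorem log_le_eight_mul_rpow₄ {x : ℝ} (hx : 0 ≤ x) :
    Real.log x ≤ 8 * x ^ ((1 : ℝ) / 8) := by
  have h := Real.log_le_rpow_div hx (by norm_num : (0 : ℝ) < 1 / 8)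
  calc Real.log x ≤ x ^ ((1 : ℝ) / 8) / (1 / 8) := h
    _ = 8 * x ^ ((1 : ℝ) / 8) := by ring

end Aux

/-! ## Part M. Towards Lemma 3 (§5): products of `k` primes, `g ≥ 1` on split-ramified integers,
and the selection inequality -/

section ProductsOfPrimes

/-- The number of ordered `k`-tuples of primes with a given product `n` is at most `k!`: such a
tuple, read as a list, is a permutation of the prime factorisation of `n`. [folklore] -/
private theorem card_filter_prod_eq_le_factorial (P : Finset ℕ) (hP : ∀ p ∈ P, p.Prime) (k n : ℕ) :
    ((Fintype.piFinset fun _ : Fin k => P).filter (fun f => ∏ j, f j = n)).card ≤ k ! := by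
  classical
  set F := (Fintype.piFinset fun _ : Fin k => P).filter (fun f => ∏ j, f j = n) with hF
  by_cases hne : F = ∅
  · rw [hne, Finset.card_empty]; exact Nat.zero_le _
  obtain ⟨f₀, hf₀⟩ := Finset.nonempty_iff_ne_empty.mpr hne
  -- every tuple in the fibre, as a list, is a permutation of `n.primeFactorsList`
  have hperm : ∀ f ∈ F, List.ofFn f ∈ n.primeFactorsList.permutations := by
    intro f hf
    rw [hF, Finset.mem_filter, Fintype.mem_piFinset] at hf
    rw [List.mem_permutations]
    refine Nat.primeFactorsList_unique ?_ fun p hp => ?_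
    · rw [List.prod_ofFn]; exact hf.2
    · obtain ⟨j, -, rfl⟩ := List.mem_ofFn' _ _ |>.mp hp
      exact hP _ (hf.1 j)
  have hlen : n.primeFactorsList.length = k := by
    have h := List.mem_permutations.mp (hperm f₀ hf₀)
    rw [← h.length_eq, List.length_ofFn]
  calc F.card ≤ (n.primeFactorsList.permutations.toFinset).card :=
        Finset.card_le_card_of_injOn (fun f => List.ofFn f)
          (fun f hf => List.mem_toFinset.mpr (hperm f hf))
          (fun f _ g _ h => List.ofFn_injective h)
    _ ≤ n.primeFactorsList.permutations.length := List.toFinset_card_le _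
    _ = k ! := by rw [List.length_permutations, hlen]

/-- **`(Σ_{p ∈ P} 1/p)^k ≤ k! · Σ_{n} 1/n`** over the products `n` of `k` primes from `P` (each such
`n` arises from at most `k!` ordered tuples). [cite: Pintz1976ElementaryII, §5 proof of Lemma 3 p. 286] -/
theorem pow_sum_inv_le_factorial_mul_sum (P : Finset ℕ) (hP : ∀ p ∈ P, p.Prime) (k : ℕ) :
    (∑ p ∈ P, 1 / (p : ℝ)) ^ k ≤
      (k ! : ℝ) * ∑ n ∈ (Fintype.piFinset fun _ : Fin k => P).image (fun f => ∏ j, f j),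
        1 / ((n : ℕ) : ℝ) := by
  classical
  -- expand the power as a sum over ordered tuples
  have hexp : (∑ p ∈ P, 1 / (p : ℝ)) ^ k =
      ∑ f ∈ Fintype.piFinset (fun _ : Fin k => P), ∏ j, 1 / ((f j : ℕ) : ℝ) := by
    have h1 : (∑ p ∈ P, 1 / (p : ℝ)) ^ k = ∏ _j : Fin k, ∑ p ∈ P, 1 / (p : ℝ) := by simp
    rw [h1]
    exact Finset.prod_univ_sum (fun _ : Fin k => P) (fun _ (p : ℕ) => 1 / (p : ℝ))
  have hterm : ∀ f : Fin k → ℕ, ∏ j, 1 / ((f j : ℕ) : ℝ) = 1 / (((∏ j, f j : ℕ)) : ℝ) := by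
    intro f
    rw [Nat.cast_prod, Finset.prod_div_distrib, Finset.prod_const_one]
  rw [hexp, Finset.sum_congr rfl fun f _ => hterm f]
  rw [Finset.sum_comp (fun n : ℕ => 1 / (n : ℝ)) (fun f : Fin k → ℕ => ∏ j, f j), Finset.mul_sum]
  refine Finset.sum_le_sum fun n _ => ?_
  rw [nsmul_eq_mul]
  exact mul_le_mul_of_nonneg_right
    (by exact_mod_cast card_filter_prod_eq_le_factorial P hP k n) (by positivity)

/-- Products of `k ≥ 1` reals from `(y, y²]` lie in `(y^k, y^{2k}]` (`y ≥ 0`). [folklore] -/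
private theorem pow_lt_prod_le {k : ℕ} (hk : 1 ≤ k) {y : ℝ} (hy : 0 < y) {f : Fin k → ℕ}
    (hf : ∀ j, y < (f j : ℝ) ∧ ((f j : ℕ) : ℝ) ≤ y ^ 2) :
    y ^ k < ((∏ j, f j : ℕ) : ℝ) ∧ ((∏ j, f j : ℕ) : ℝ) ≤ y ^ (2 * k) := by
  haveI : Nonempty (Fin k) := ⟨⟨0, hk⟩⟩
  rw [Nat.cast_prod]
  constructor
  · calc y ^ k = ∏ _j : Fin k, y := by rw [Finset.prod_const, Finset.card_univ, Fintype.card_fin]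
      _ < ∏ j, ((f j : ℕ) : ℝ) :=
          Finset.prod_lt_prod_of_nonempty (fun j _ => hy)
            (fun j _ => (hf j).1) Finset.univ_nonempty
  · calc ∏ j, ((f j : ℕ) : ℝ) ≤ ∏ _j : Fin k, y ^ 2 :=
          Finset.prod_le_prod (fun j _ => by positivity) fun j _ => (hf j).2
      _ = y ^ (2 * k) := by rw [Finset.prod_const, Finset.card_univ, Fintype.card_fin, ← pow_mul]

/-- The prime factors of a product of primes from `P` lie in `P`. [folklore] -/
private theorem primeFactors_prod_subset (P : Finset ℕ) (hP : ∀ p ∈ P, p.Prime) {k : ℕ} {f : Fin k → ℕ}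
    (hf : ∀ j, f j ∈ P) : (∏ j, f j).primeFactors ⊆ P := by
  classical
  intro q hq
  obtain ⟨hqp, hqdvd, -⟩ := Nat.mem_primeFactors.mp hq
  obtain ⟨j, -, hj⟩ := (Nat.Prime.prime hqp).exists_mem_finset_dvd hqdvd
  rw [(Nat.prime_dvd_prime_iff_eq hqp (hP _ (hf j))).mp hj]
  exact hf j

end ProductsOfPrimes

section GOne

variable {D : ℕ} [NeZero D] (χ : DirichletCharacter ℂ D)

/-- **`g(n) ≥ 1` when every prime factor `p` of `n` has `χ(p) ≠ −1`** ("if for all `p` prime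
factors of `n` `χ(p) ≠ −1`, then `g(n) ≥ 1`", p. 286): by (2.7), each local factor
`1 + χ(p) + ⋯ + χ(p)^α` is `α + 1` or `1`. [cite: Pintz1976ElementaryII, §5 p. 286] -/
theorem one_le_g_of_forall_primeFactors (hq : χ ^ 2 = 1) {n : ℕ} (hn : n ≠ 0)
    (h : ∀ p ∈ n.primeFactors, χ (p : ZMod D) ≠ -1) : 1 ≤ g χ n := by
  rw [g_eq_charDivisorSum,
    (isMultiplicative_charDivisorSum χ hq).multiplicative_factorization _ hn, Finsupp.prod]
  rw [show (1 : ℝ) = ∏ r ∈ n.factorization.support, (1 : ℝ) by simp]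
  refine prod_le_prod (fun _ _ => zero_le_one) fun r hr => ?_
  rw [Nat.support_factorization] at hr
  have hrp : r.Prime := Nat.prime_of_mem_primeFactors hr
  rw [charDivisorSum_prime_pow χ hq hrp]
  rcases reChar_trichotomy χ hq r with hc | hc | hc
  · rw [hc, zero_geom_sum, if_neg (Nat.succ_ne_zero _)]
  · rw [hc]; simp
  · exfalso
    refine h r hr ?_
    rw [← ofReal_reChar χ hq hrp.ne_zero, hc]; push_cast; ring

end GOne

section Selection

/-- **The selection inequality** (replacing the printed choice of one interval, p. 286): if
`α ≤ Σ_{j<m} σ_j` with `σ_j^{2^j} ≤ (2^j)! U` for each `j < m` (`m ≥ 1`, `U ≥ 0`), and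
`0 ≤ α ≤ M`, `2^m ≤ M`, then `(α/M)^M ≤ U`. (Otherwise `σ_j < 2^j (α/M)²` for every `j`, and
`α < (2^m − 1)(α/M)² ≤ α`.) [cite: Pintz1976ElementaryII, §5 proof of Lemma 3 p. 286] -/
theorem rpow_div_le_of_pow_le_factorial_mul {m : ℕ} (hm : 1 ≤ m) {σ : ℕ → ℝ}
    {α M U : ℝ} (hα0 : 0 ≤ α) (hαM : α ≤ M) (hM : (2 : ℝ) ^ m ≤ M)
    (hU0 : 0 ≤ U) (hsum : α ≤ ∑ j ∈ Finset.range m, σ j)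
    (hT : ∀ j ∈ Finset.range m, σ j ^ (2 ^ j) ≤ ((2 ^ j) ! : ℝ) * U) :
    (α / M) ^ M ≤ U := by
  by_contra hlt
  push Not at hlt
  have hMpos : 0 < M := lt_of_lt_of_le (by positivity) hM
  -- `α > 0` (otherwise the left side vanishes)
  rcases hα0.eq_or_lt with hαz | hαpos
  · rw [← hαz, zero_div, Real.zero_rpow hMpos.ne'] at hlt
    exact absurd hlt (not_lt.mpr hU0)
  set u : ℝ := α / M with hu
  have hu0 : 0 < u := by positivity
  have hu1 : u ≤ 1 := by rw [hu, div_le_one hMpos]; exact hαM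
  -- each `σ_j < 2^j u²`
  have hσlt : ∀ j ∈ Finset.range m, σ j < ((2 ^ j : ℕ) : ℝ) * u ^ 2 := by
    intro j hj
    have hjm : j < m := Finset.mem_range.mp hj
    set k : ℕ := 2 ^ j with hk
    have hk1 : 1 ≤ k := Nat.one_le_two_pow
    have hkr : (1 : ℝ) ≤ k := by exact_mod_cast hk1
    -- `u^{M/k} ≤ u²` since `M/k ≥ 2`
    have hMk : 2 ≤ M / k := by
      rw [le_div_iff₀ (by positivity)]
      calc 2 * (k : ℝ) = (2 : ℝ) ^ (j + 1) := by rw [hk]; push_cast; ring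
        _ ≤ (2 : ℝ) ^ m := pow_le_pow_right₀ (by norm_num) hjm
        _ ≤ M := hM
    have hroot : (u ^ M) ^ (1 / (k : ℝ)) = u ^ (M / k) := by
      rw [← Real.rpow_mul hu0.le]; congr 1; field_simp
    have hrootle : u ^ (M / k) ≤ u ^ 2 := by
      rw [show u ^ 2 = u ^ (2 : ℝ) by norm_cast]
      exact Real.rpow_le_rpow_of_exponent_ge hu0 hu1 hMk
    -- if `σ_j ≥ k u²` then `σ_j^k ≥ k^k u^{M} ≥ k! u^M > k! U`
    by_contra hge
    push Not at hge
    have hkk : ((k !) : ℝ) ≤ (k : ℝ) ^ k := by exact_mod_cast Nat.factorial_le_pow k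
    have h1 : ((k : ℝ) * u ^ 2) ^ k ≤ σ j ^ k := pow_le_pow_left₀ (by positivity) hge k
    have h2 : (k : ℝ) ^ k * u ^ M ≤ ((k : ℝ) * u ^ 2) ^ k := by
      rw [mul_pow]
      refine mul_le_mul_of_nonneg_left ?_ (by positivity)
      calc u ^ M = (u ^ (M / k)) ^ (k : ℝ) := by
            rw [← Real.rpow_mul hu0.le]; congr 1; field_simp
        _ = (u ^ (M / k)) ^ k := by rw [Real.rpow_natCast]
        _ ≤ (u ^ 2) ^ k := pow_le_pow_left₀ (Real.rpow_nonneg hu0.le _) hrootle k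
    have h3 : ((k !) : ℝ) * u ^ M ≤ (k : ℝ) ^ k * u ^ M :=
      mul_le_mul_of_nonneg_right hkk (Real.rpow_nonneg hu0.le _)
    have h4 : ((k !) : ℝ) * U < ((k !) : ℝ) * u ^ M :=
      mul_lt_mul_of_pos_left hlt (by positivity)
    have := hT j hj
    rw [← hk] at this
    linarith
  -- sum: `α < (2^m − 1) u² ≤ M u² ≤ α`
  have hne : (Finset.range m).Nonempty := ⟨0, Finset.mem_range.mpr hm⟩
  have hlt2 : ∑ j ∈ Finset.range m, σ j < ∑ j ∈ Finset.range m, ((2 ^ j : ℕ) : ℝ) * u ^ 2 :=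
    Finset.sum_lt_sum_of_nonempty hne hσlt
  have hgeom : ∑ j ∈ Finset.range m, ((2 ^ j : ℕ) : ℝ) * u ^ 2 ≤ M * u ^ 2 := by
    rw [← Finset.sum_mul]
    refine mul_le_mul_of_nonneg_right ?_ (by positivity)
    have hg : ∑ j ∈ Finset.range m, ((2 ^ j : ℕ) : ℝ) = 2 ^ m - 1 := by
      push_cast
      have := geom_sum_eq (show (2 : ℝ) ≠ 1 by norm_num) m
      rw [this]; ring
    rw [hg]; linarith
  have hfin : M * u ^ 2 ≤ α := by
    calc M * u ^ 2 = α * u := by rw [hu]; field_simp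
      _ ≤ α * 1 := mul_le_mul_of_nonneg_left hu1 hα0
      _ = α := mul_one α
  linarith

end Selection

/-! ### Lemma 3 in threshold form

PRINT (Lemma 3, p. 286): "For a non-principal real character `χ (mod D)` (`≥ 1500`) for any `A`,
`2 ≤ A ≤ D²`, and with the notation `Σ_{A<p≤D², χ(p)≠−1} 1/p = α` (5.1) the inequality
`L(1) > (1/(5 log D))(α log A/(8 log D))^{8 log D/log A}` (5.2) holds." Proof (pp. 286–287):
intervals `(A^{2^{i−1}}, A^{2^i}]`, `i ≤ m`, `C = A^{2^{m−1}} < D⁴ ≤ C²`; the products of `2^{m−i}`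
primes `p` of the `i`-th interval with `χ(p) ≠ −1` are integers `C < n ≤ C²` all of whose prime
factors have `χ(p) ≠ −1` (so `g(n) ≥ 1`), each arising with multiplicity `≤ (2^{m−i})!`; "(since
`α < m`)" (5.3) `Σ_{C<n≤C²} g(n)/n > (α log A/(8 log D))^{8 log D/log A}`; (5.4) Lemma 1 at
`x = C, C²`: `Σ_{C<n≤C²} g(n)/n ≤ 4 log D·L(1) + 20 log D/D^{3/4} < 5 log D·L(1)` (`√D L(1) ≥ π`).
HERE, in threshold form (for Theorem 4): the same architecture with `C = A^{2^{m−1}} ∈ [D⁴, D⁸)`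
(so that the tree's substitute for Lemma 1 — Montgomery–Vaughan 11.2.3(g), `sum_Ioc_g_div_le`, with
`Y = ⌊√N⌋` — has error `≤ 280(1 + log D) log D/D^{3/2} ≤ (log D − 1) L(1)` for `D ≥ 65536`, by
`√D L(1) ≥ 2/3`), whence the exponent `16 log D/log A` and the constant `9 log D`; and the printed
selection of one interval "(since `α < m`)" is replaced by `rpow_div_le_of_pow_le_factorial_mul`
under the hypothesis `α ≤ 16 log D/log A` (supplied by Mertens' theorem where Theorem 4 uses it).
The printed constants (`1500`, `5`, `8`) are those of the named fact `pintz1976_lemma3`, which is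
not discharged here. -/

section LemmaThreeWeak

variable {D : ℕ} [NeZero D] (χ : DirichletCharacter ℂ D)

/-- `√D · L(1, χ) ≥ 2/3` for a real primitive character mod `D ≥ 2` (the tree's `2π/9` for odd and
`3/4` for even characters, by the class number formula). [cite: MontgomeryVaughan2007, Theorem 9.13] -/
theorem two_thirds_le_sqrt_mul_lOne (hprim : χ.IsPrimitive) (hquad : χ.IsQuadratic) (hD : 2 ≤ D) :
    2 / 3 ≤ Real.sqrt D * (χ.LFunction 1).re := by
  have hne : χ ≠ 1 := by
    intro h1
    have hc : χ.conductor = 1 := by rw [h1]; exact DirichletCharacter.conductor_one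
    rw [hprim] at hc
    omega
  have hq : χ ^ 2 = 1 := MulChar.IsQuadratic.sq_eq_one hquad
  rw [Siegel.LFunction_one_re_eq_norm χ hne hq]
  rcases χ.even_or_odd with heven | hodd
  · have := sqrt_mul_norm_LFunction_one_ge_of_even (by omega) hprim hquad heven
    linarith
  · have := sqrt_mul_norm_LFunction_one_ge_of_odd hprim hquad hodd
    linarith [Real.pi_gt_three]

omit [NeZero D] in
/-- `log D ≥ 2` for `D ≥ 16`. [folklore] -/
private theorem two_le_log {D : ℕ} (hD : 16 ≤ D) : 2 ≤ Real.log D := by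
  have hD' : (16 : ℝ) ≤ D := by exact_mod_cast hD
  rw [Real.le_log_iff_exp_le (by linarith)]
  have h1 := Real.exp_one_lt_d9
  have h2 : Real.exp 2 = Real.exp 1 * Real.exp 1 := by rw [← Real.exp_add]; norm_num
  nlinarith [Real.exp_pos 1]

omit [NeZero D] in
/-- The numerics of the threshold: for `D ≥ 65536`, `420 (1 + log D) log D ≤ (log D − 1) D`
(`log D ≤ 8 D^{1/8}`, `D^{7/8} ≥ 4⁷ > 10080`). [folklore] -/
private theorem threshold_numerics {D : ℕ} (hD : 65536 ≤ D) :
    420 * (1 + Real.log D) * Real.log D ≤ (Real.log D - 1) * D := by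
  have hD' : (65536 : ℝ) ≤ D := by exact_mod_cast hD
  have hD0 : (0 : ℝ) < D := by linarith
  obtain ⟨u, hu⟩ : ∃ u : ℝ, u = (D : ℝ) ^ ((1 : ℝ) / 8) := ⟨_, rfl⟩
  have hu0 : 0 < u := by rw [hu]; exact Real.rpow_pos_of_pos hD0 _
  have hu8 : u ^ 8 = (D : ℝ) := by rw [hu, ← Real.rpow_mul_natCast hD0.le]; norm_num
  have hu4 : 4 ≤ u := by
    have h1 : ((4 : ℝ)) ^ 8 ≤ u ^ 8 := by
      rw [hu8]
      calc ((4 : ℝ)) ^ 8 = 65536 := by norm_num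
        _ ≤ D := hD'
    exact le_of_pow_le_pow_left₀ (by norm_num) hu0.le h1
  have hlog : Real.log D ≤ 8 * u := by rw [hu]; exact log_le_eight_mul_rpow₄ hD0.le
  have hlog2 : 2 ≤ Real.log D := two_le_log (le_trans (by norm_num) hD)
  have hu7 : (10080 : ℝ) ≤ u ^ 7 := le_trans (by norm_num) (pow_le_pow_left₀ (by norm_num) hu4 7)
  have hL0 : 0 ≤ Real.log D := by linarith
  have hLm : 0 ≤ Real.log D - 1 := by linarith
  have h3 : 1 + Real.log D ≤ 3 * (Real.log D - 1) := by linarith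
  calc 420 * (1 + Real.log D) * Real.log D ≤ 420 * (3 * (Real.log D - 1)) * (8 * u) := by
        have := mul_le_mul h3 hlog hL0 (by linarith)
        nlinarith [this]
    _ = (Real.log D - 1) * (10080 * u) := by ring
    _ ≤ (Real.log D - 1) * (u ^ 7 * u) :=
        mul_le_mul_of_nonneg_left (mul_le_mul_of_nonneg_right hu7 hu0.le) hLm
    _ = (Real.log D - 1) * D := by rw [← hu8]; ring

omit [NeZero D] in
/-- The Montgomery–Vaughan error at `N ≥ D⁴` with `Y = ⌊√N⌋` and `log N + 1 ≤ 17 log D`: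
`8√D(1 + log D)(log N + 1)/(Y + 1) + 4Y/N ≤ 140 (1 + log D) log D/(D√D)`. [folklore] -/
private theorem mv_error_le {D : ℕ} (hD : 2 ≤ D) {N : ℕ} (hN : D ^ 4 ≤ N)
    (hlogN : Real.log N + 1 ≤ 17 * Real.log D) :
    8 * (Real.sqrt D * (1 + Real.log D)) * (Real.log N + 1) / ((Nat.sqrt N : ℝ) + 1) +
        4 * (Nat.sqrt N : ℝ) / N ≤
      140 * (1 + Real.log D) * Real.log D / ((D : ℝ) * Real.sqrt D) := by
  have hD2 : (2 : ℝ) ≤ D := by exact_mod_cast hD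
  have hD0 : (0 : ℝ) < D := by linarith
  have hsD : 0 < Real.sqrt D := Real.sqrt_pos.2 hD0
  have hsD2 : Real.sqrt D * Real.sqrt D = D := Real.mul_self_sqrt hD0.le
  have hlogD : 0 < Real.log D := Real.log_pos (by linarith)
  have hlog2 : Real.log 2 ≤ Real.log D := Real.log_le_log (by norm_num) hD2
  have hN4 : ((D : ℝ)) ^ 4 ≤ N := by exact_mod_cast hN
  have hN0 : (0 : ℝ) < N := lt_of_lt_of_le (by positivity) hN4
  have hsN0 : 0 < Real.sqrt N := Real.sqrt_pos.2 hN0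
  have hsN2 : Real.sqrt N * Real.sqrt N = N := Real.mul_self_sqrt hN0.le
  have hlogN0 : 0 ≤ Real.log N := Real.log_nonneg (by linarith [show (1:ℝ) ≤ (D:ℝ)^4 from one_le_pow₀ (by linarith)])
  -- `Y + 1 ≥ √N ≥ D²`, `Y ≤ √N`
  have hY1 : Real.sqrt N ≤ (Nat.sqrt N : ℝ) + 1 := by
    have h := Nat.lt_succ_sqrt' N
    have h' : (N : ℝ) < (((Nat.sqrt N) + 1 : ℕ) : ℝ) ^ 2 := by exact_mod_cast h
    push_cast at h'
    calc Real.sqrt N ≤ Real.sqrt ((((Nat.sqrt N) : ℝ) + 1) ^ 2) := Real.sqrt_le_sqrt h'.le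
      _ = (Nat.sqrt N : ℝ) + 1 := Real.sqrt_sq (by positivity)
  have hY2 : (Nat.sqrt N : ℝ) ≤ Real.sqrt N := by
    have h := Nat.sqrt_le' N
    have h' : ((Nat.sqrt N : ℕ) : ℝ) ^ 2 ≤ N := by exact_mod_cast h
    calc (Nat.sqrt N : ℝ) = Real.sqrt (((Nat.sqrt N : ℕ) : ℝ) ^ 2) :=
          (Real.sqrt_sq (by positivity)).symm
      _ ≤ Real.sqrt N := Real.sqrt_le_sqrt h'
  have hsN : (D : ℝ) ^ 2 ≤ Real.sqrt N := by
    calc ((D : ℝ)) ^ 2 = Real.sqrt (((D : ℝ) ^ 2) ^ 2) := (Real.sqrt_sq (by positivity)).symm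
      _ ≤ Real.sqrt N := Real.sqrt_le_sqrt (by nlinarith)
  -- first term: `≤ 8√D(1+L)·17L/√N ≤ 136 (1+L) L √D/D² = 136(1+L)L/(D√D)`
  have h1 : 8 * (Real.sqrt D * (1 + Real.log D)) * (Real.log N + 1) / ((Nat.sqrt N : ℝ) + 1) ≤
      136 * (1 + Real.log D) * Real.log D / ((D : ℝ) * Real.sqrt D) := by
    have hnum0 : 0 ≤ 8 * (Real.sqrt D * (1 + Real.log D)) := by positivity
    calc 8 * (Real.sqrt D * (1 + Real.log D)) * (Real.log N + 1) / ((Nat.sqrt N : ℝ) + 1)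
        ≤ 8 * (Real.sqrt D * (1 + Real.log D)) * (17 * Real.log D) / Real.sqrt N := by
          gcongr
      _ ≤ 8 * (Real.sqrt D * (1 + Real.log D)) * (17 * Real.log D) / (D : ℝ) ^ 2 :=
          div_le_div_of_nonneg_left (by positivity) (by positivity) hsN
      _ = 136 * (1 + Real.log D) * Real.log D / ((D : ℝ) * Real.sqrt D) := by
          rw [div_eq_div_iff (by positivity) (by positivity)]
          have : ((D : ℝ)) ^ 2 = (D : ℝ) * Real.sqrt D * Real.sqrt D := by rw [mul_assoc, hsD2]; ring
          rw [this]; ring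
  -- second term: `4Y/N ≤ 4/√N ≤ 4/D² ≤ 4(1+L)L/(D√D)`
  have h2 : 4 * (Nat.sqrt N : ℝ) / N ≤ 4 * (1 + Real.log D) * Real.log D / ((D : ℝ) * Real.sqrt D) := by
    calc 4 * (Nat.sqrt N : ℝ) / N ≤ 4 * Real.sqrt N / N := by gcongr
      _ = 4 / Real.sqrt N := by
          rw [div_eq_div_iff hN0.ne' hsN0.ne', mul_assoc, hsN2]
      _ ≤ 4 / (D : ℝ) ^ 2 := div_le_div_of_nonneg_left (by norm_num) (by positivity) hsN
      _ ≤ 4 * (1 + Real.log D) * Real.log D / ((D : ℝ) * Real.sqrt D) := by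
          rw [div_le_div_iff₀ (by positivity) (by positivity)]
          -- `4 D √D ≤ 4 (1+L) L D²`: `√D ≤ D` and `(1+L)L ≥ 1`
          have hsle : Real.sqrt D ≤ D := by nlinarith [hsD2, hsD]
          have hLL : 1 ≤ (1 + Real.log D) * Real.log D := by nlinarith [Real.log_two_gt_d9]
          have hDs0 : 0 ≤ (D : ℝ) * Real.sqrt D := by positivity
          calc 4 * ((D : ℝ) * Real.sqrt D) ≤ 4 * ((D : ℝ) * D) * 1 := by nlinarith
            _ ≤ 4 * ((D : ℝ) * D) * ((1 + Real.log D) * Real.log D) :=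
                mul_le_mul_of_nonneg_left hLL (by positivity)
            _ = 4 * (1 + Real.log D) * Real.log D * (D : ℝ) ^ 2 := by ring
  calc _ ≤ 136 * (1 + Real.log D) * Real.log D / ((D : ℝ) * Real.sqrt D) +
        4 * (1 + Real.log D) * Real.log D / ((D : ℝ) * Real.sqrt D) := add_le_add h1 h2
    _ = 140 * (1 + Real.log D) * Real.log D / ((D : ℝ) * Real.sqrt D) := by ring

/-- **Lemma 3 in threshold form, PROVED.** There is `D₀` such that for `D ≥ D₀`, every real
primitive `χ` mod `D`, every `2 ≤ A ≤ D²`, with `α = Σ_{A<p≤D², χ(p)≠−1} 1/p ≤ 16 log D/log A`: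
`(α log A/(16 log D))^{16 log D/log A} ≤ 9 log D · L(1, χ)`.
[cite: Pintz1976ElementaryII, Lemma 3 p. 286 (5.1)–(5.2), proof pp. 286–287] -/
theorem lemma3_weak :
    ∃ D₀ : ℕ, ∀ (D : ℕ) [NeZero D], D₀ ≤ D → ∀ χ : DirichletCharacter ℂ D, χ.IsQuadratic →
      χ.IsPrimitive → ∀ A : ℝ, 2 ≤ A → A ≤ (D : ℝ) ^ 2 →
        (∑ p ∈ (Finset.range (D ^ 2 + 1)).filter
            (fun p : ℕ => p.Prime ∧ A < (p : ℝ) ∧ χ (p : ZMod D) ≠ -1), (1 : ℝ) / (p : ℝ)) ≤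
          16 * Real.log D / Real.log A →
        ((∑ p ∈ (Finset.range (D ^ 2 + 1)).filter
              (fun p : ℕ => p.Prime ∧ A < (p : ℝ) ∧ χ (p : ZMod D) ≠ -1), (1 : ℝ) / (p : ℝ)) *
            Real.log A / (16 * Real.log D)) ^ (16 * Real.log D / Real.log A) ≤
          9 * Real.log D * (χ.LFunction 1).re := by
  refine ⟨65536, fun D _ hD χ hquad hprim A hA2 hAD hαM => ?_⟩
  classical
  obtain ⟨α, hα⟩ : ∃ α : ℝ, α = ∑ p ∈ (Finset.range (D ^ 2 + 1)).filter
      (fun p : ℕ => p.Prime ∧ A < (p : ℝ) ∧ χ (p : ZMod D) ≠ -1), (1 : ℝ) / (p : ℝ) := ⟨_, rfl⟩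
  rw [← hα] at hαM ⊢
  obtain ⟨L, hL⟩ : ∃ L : ℝ, L = Real.log D := ⟨_, rfl⟩
  obtain ⟨ℓ, hℓ⟩ : ∃ ℓ : ℝ, ℓ = Real.log A := ⟨_, rfl⟩
  rw [← hL, ← hℓ] at hαM ⊢
  have hq : χ ^ 2 = 1 := MulChar.IsQuadratic.sq_eq_one hquad
  have hD' : (65536 : ℝ) ≤ D := by exact_mod_cast hD
  have hD0 : (0 : ℝ) < D := by linarith only [hD']
  have hD2 : 2 ≤ D := le_trans (by norm_num) hD
  have hL2 : 2 ≤ L := by rw [hL]; exact two_le_log (le_trans (by norm_num) hD)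
  have hLpos : 0 < L := by linarith only [hL2]
  have hℓpos : 0 < ℓ := by rw [hℓ]; exact Real.log_pos (by linarith only [hA2])
  have hA0 : 0 < A := by linarith only [hA2]
  have hA1 : 1 ≤ A := by linarith only [hA2]
  have hℓ2L : ℓ ≤ 2 * L := by
    rw [hℓ, hL]
    have h := Real.log_le_log hA0 hAD
    rw [Real.log_pow] at h
    push_cast at h
    linarith only [h]
  have hlog2 : Real.log 2 < 1 := by
    have := Real.log_two_lt_d9; linarith only [this]
  have hsD : 0 < Real.sqrt D := Real.sqrt_pos.2 hD0
  -- `L(1) > 0`, `√D L(1) ≥ 2/3`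
  have hL1 := two_thirds_le_sqrt_mul_lOne χ hprim hquad hD2
  have hL1pos : 0 < (χ.LFunction 1).re := by
    by_contra h; push Not at h
    have : Real.sqrt D * (χ.LFunction 1).re ≤ 0 := mul_nonpos_of_nonneg_of_nonpos hsD.le h
    linarith only [this, hL1]
  -- `t = 8L/ℓ ≥ 4`, `m = ⌈log₂ t⌉`, `K = 2^{m−1}`: `K < t ≤ 2K`
  obtain ⟨t, ht⟩ : ∃ t : ℝ, t = 8 * L / ℓ := ⟨_, rfl⟩
  have ht4 : 4 ≤ t := by rw [ht, le_div_iff₀ hℓpos]; linarith only [hℓ2L]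
  have ht0 : 0 ≤ t := by linarith only [ht4]
  obtain ⟨m, hm⟩ : ∃ m : ℕ, m = Nat.clog 2 ⌈t⌉₊ := ⟨_, rfl⟩
  have hceil1 : 1 < ⌈t⌉₊ := Nat.lt_ceil.mpr (by push_cast; linarith only [ht4])
  have htm : t ≤ (2 : ℝ) ^ m := by
    have h1 := Nat.le_pow_clog one_lt_two ⌈t⌉₊
    rw [← hm] at h1
    calc t ≤ ⌈t⌉₊ := Nat.le_ceil t
      _ ≤ ((2 ^ m : ℕ) : ℝ) := by exact_mod_cast h1
      _ = (2 : ℝ) ^ m := by push_cast; ring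
  have hm1 : 1 ≤ m := by
    rcases Nat.eq_zero_or_pos m with h0 | h0
    · rw [h0, pow_zero] at htm; linarith only [htm, ht4]
    · exact h0
  obtain ⟨K, hK⟩ : ∃ K : ℕ, K = 2 ^ (m - 1) := ⟨_, rfl⟩
  have hK1 : 1 ≤ K := by rw [hK]; exact Nat.one_le_two_pow
  have h2K : 2 * K = 2 ^ m := by
    rw [hK, ← pow_succ']; congr 1; omega
  have hKt : (K : ℝ) < t := by
    have h1 := Nat.pow_pred_clog_lt_self one_lt_two hceil1
    rw [← hm, Nat.pred_eq_sub_one, ← hK] at h1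
    have h2 : (K : ℝ) + 1 ≤ (⌈t⌉₊ : ℝ) := by exact_mod_cast h1
    linarith only [h2, Nat.ceil_lt_add_one ht0]
  have h2Kt : t ≤ 2 * (K : ℝ) := by
    calc t ≤ (2 : ℝ) ^ m := htm
      _ = ((2 ^ m : ℕ) : ℝ) := by push_cast; ring
      _ = 2 * (K : ℝ) := by rw [← h2K]; push_cast; ring
  have hKℓ8 : (K : ℝ) * ℓ < 8 * L := by
    rw [ht, lt_div_iff₀ hℓpos] at hKt; linarith only [hKt]
  have hKℓ4 : 4 * L ≤ (K : ℝ) * ℓ := by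
    rw [ht, div_le_iff₀ hℓpos] at h2Kt; linarith only [h2Kt]
  have hM : (2 : ℝ) ^ m ≤ 16 * L / ℓ := by
    rw [le_div_iff₀ hℓpos]
    have : (2 : ℝ) ^ m = 2 * K := by
      rw [show (2 : ℝ) ^ m = ((2 ^ m : ℕ) : ℝ) by push_cast; ring, ← h2K]; push_cast; ring
    rw [this]; nlinarith only [hKℓ8]
  -- `C = A^K ∈ [D⁴, D⁸)`
  obtain ⟨C, hC⟩ : ∃ C : ℝ, C = A ^ K := ⟨_, rfl⟩
  have hC0 : 0 < C := by rw [hC]; positivity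
  have hlogC : Real.log C = K * ℓ := by rw [hC, Real.log_pow, hℓ]
  have hCD4 : (D : ℝ) ^ 4 ≤ C := by
    have h1 : Real.log ((D : ℝ) ^ 4) ≤ Real.log C := by
      rw [Real.log_pow, hlogC, ← hL]; push_cast; linarith only [hKℓ4]
    exact (Real.log_le_log_iff (by positivity) hC0).mp h1
  have hD4ge : (65536 : ℝ) ≤ (D : ℝ) ^ 4 :=
    le_trans hD' (le_self_pow₀ (by linarith only [hD']) (by norm_num))
  have hC2 : 2 ≤ C := by linarith only [hD4ge, hCD4]
  have hCC : C ≤ C ^ 2 := by nlinarith only [hC2]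
  -- `N₁ = ⌊C⌋`, `N₂ = ⌊C²⌋`
  obtain ⟨N₁, hN₁⟩ : ∃ N₁ : ℕ, N₁ = ⌊C⌋₊ := ⟨_, rfl⟩
  obtain ⟨N₂, hN₂⟩ : ∃ N₂ : ℕ, N₂ = ⌊C ^ 2⌋₊ := ⟨_, rfl⟩
  have hN₁D : D ^ 4 ≤ N₁ := by
    rw [hN₁]; exact Nat.le_floor (by push_cast; exact hCD4)
  have hN₁₂ : N₁ ≤ N₂ := by rw [hN₁, hN₂]; exact Nat.floor_le_floor hCC
  have hN₂D : D ^ 4 ≤ N₂ := hN₁D.trans hN₁₂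
  have hN₁r : C / 2 ≤ (N₁ : ℝ) := by
    have h1 : C < (N₁ : ℝ) + 1 := by rw [hN₁]; exact Nat.lt_floor_add_one C
    linarith only [h1, hC2]
  have hN₁le : (N₁ : ℝ) ≤ C := by rw [hN₁]; exact Nat.floor_le hC0.le
  have hN₂r : (N₂ : ℝ) ≤ C ^ 2 := by rw [hN₂]; exact Nat.floor_le (by positivity)
  have hN₁pos : (0 : ℝ) < N₁ := by linarith only [hN₁r, hC2]
  have hN₂pos : (0 : ℝ) < N₂ := lt_of_lt_of_le hN₁pos (by exact_mod_cast hN₁₂)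
  have hlogN₂ : Real.log N₂ ≤ 2 * ((K : ℝ) * ℓ) := by
    calc Real.log N₂ ≤ Real.log (C ^ 2) := Real.log_le_log hN₂pos hN₂r
      _ = 2 * ((K : ℝ) * ℓ) := by rw [Real.log_pow, hlogC]; push_cast; ring
  have hlogN₁ : (K : ℝ) * ℓ - Real.log 2 ≤ Real.log N₁ := by
    calc (K : ℝ) * ℓ - Real.log 2 = Real.log (C / 2) := by
          rw [Real.log_div hC0.ne' two_ne_zero, hlogC]
      _ ≤ Real.log N₁ := Real.log_le_log (by positivity) hN₁r
  have hlogN₁' : Real.log N₁ ≤ 2 * ((K : ℝ) * ℓ) :=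
    (Real.log_le_log hN₁pos (by exact_mod_cast hN₁₂)).trans hlogN₂
  have h17₁ : Real.log N₁ + 1 ≤ 17 * L := by linarith only [hlogN₁', hKℓ8, hL2]
  have h17₂ : Real.log N₂ + 1 ≤ 17 * L := by linarith only [hlogN₂, hKℓ8, hL2]
  -- `U = Σ_{N₁<n≤N₂} g(n)/n ≤ 9 L · L(1)`
  obtain ⟨U, hU⟩ : ∃ U : ℝ, U = ∑ n ∈ Finset.Ioc N₁ N₂, g χ n / (n : ℝ) := ⟨_, rfl⟩
  have hU0 : 0 ≤ U := by
    rw [hU]; exact Finset.sum_nonneg fun n _ => div_nonneg (g_nonneg χ hq n) (Nat.cast_nonneg n)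
  have hsq4 : ∀ N : ℕ, D ^ 4 ≤ N → 2 ≤ Nat.sqrt N ∧ Nat.sqrt N ≤ N := by
    intro N hN
    refine ⟨Nat.le_sqrt.mpr (le_trans ?_ hN), Nat.sqrt_le_self N⟩
    calc 2 * 2 ≤ 2 ^ 4 := by norm_num
      _ ≤ D ^ 4 := Nat.pow_le_pow_left hD2 4
  have hUle : U ≤ 9 * L * (χ.LFunction 1).re := by
    have hmv := sum_Ioc_g_div_le χ hprim hD2 (hsq4 N₁ hN₁D).1 (hsq4 N₁ hN₁D).2
      (hsq4 N₂ hN₂D).1 (hsq4 N₂ hN₂D).2 hN₁₂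
    have hE₁ := mv_error_le hD2 hN₁D (by rw [← hL]; exact h17₁)
    have hE₂ := mv_error_le hD2 hN₂D (by rw [← hL]; exact h17₂)
    rw [← hL] at hE₁ hE₂
    have hnum := threshold_numerics hD
    rw [← hL] at hnum
    -- the error is at most `(L − 1) L(1)`
    have herr : 2 * (140 * (1 + L) * L / ((D : ℝ) * Real.sqrt D)) ≤ (L - 1) * (χ.LFunction 1).re := by
      rw [show 2 * (140 * (1 + L) * L / ((D : ℝ) * Real.sqrt D)) =
          280 * (1 + L) * L / ((D : ℝ) * Real.sqrt D) by ring,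
        div_le_iff₀ (by positivity)]
      -- `280(1+L)L ≤ (2/3)(L−1)D ≤ (L−1) L(1) D √D`
      have h1 : 280 * (1 + L) * L ≤ 2 / 3 * ((L - 1) * D) := by linarith only [hnum]
      have hLm : 0 ≤ L - 1 := by linarith only [hL2]
      have h2 : 2 / 3 * ((L - 1) * D) ≤ (L - 1) * D * (Real.sqrt D * (χ.LFunction 1).re) := by
        have := mul_le_mul_of_nonneg_left hL1 (mul_nonneg hLm hD0.le)
        linarith only [this]
      calc 280 * (1 + L) * L ≤ (L - 1) * D * (Real.sqrt D * (χ.LFunction 1).re) := h1.trans h2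
        _ = (L - 1) * (χ.LFunction 1).re * ((D : ℝ) * Real.sqrt D) := by ring
    -- the main term is at most `(8L + 1) L(1)`
    have hmain : (χ.LFunction 1).re * (Real.log N₂ - Real.log N₁) ≤
        (8 * L + 1) * (χ.LFunction 1).re := by
      have h1 : Real.log N₂ - Real.log N₁ ≤ 8 * L + 1 := by
        linarith only [hlogN₂, hlogN₁, hKℓ8, hlog2]
      nlinarith only [h1, hL1pos]
    rw [hU]
    rw [← hL] at hmv
    linarith only [hmv, hE₁, hE₂, herr, hmain]
  -- the intervals `I_j = (y_j, y_j²]`, `y_j = A^{2^{m−1−j}}`, `j < m`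
  obtain ⟨y, hy⟩ : ∃ y : ℕ → ℝ, y = fun j => A ^ 2 ^ (m - 1 - j) := ⟨_, rfl⟩
  have hyj : ∀ j, y j = A ^ 2 ^ (m - 1 - j) := fun j => by rw [hy]
  have hypos : ∀ j, 0 < y j := fun j => by rw [hyj]; positivity
  have hyK : ∀ j, j < m → y j ^ 2 ^ j = C := by
    intro j hj
    rw [hyj, ← pow_mul, ← pow_add, Nat.sub_add_cancel (by omega : j ≤ m - 1), hC, hK]
  have hysq : ∀ j, j + 1 < m → y j = y (j + 1) ^ 2 := by
    intro j hj
    rw [hyj, hyj, ← pow_mul, ← pow_succ]; congr 1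
    rw [show m - 1 - j = m - 1 - (j + 1) + 1 by omega]
  obtain ⟨I, hI⟩ : ∃ I : ℕ → Finset ℕ, I = fun j => (Finset.range (N₂ + 1)).filter
      (fun p : ℕ => p.Prime ∧ y j < (p : ℝ) ∧ (p : ℝ) ≤ y j ^ 2 ∧ χ (p : ZMod D) ≠ -1) := ⟨_, rfl⟩
  have hmemI : ∀ j p, p ∈ I j ↔ p < N₂ + 1 ∧ p.Prime ∧ y j < (p : ℝ) ∧ (p : ℝ) ≤ y j ^ 2 ∧
      χ (p : ZMod D) ≠ -1 := by
    intro j p; rw [hI, Finset.mem_filter, Finset.mem_range]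
  have hIprime : ∀ j, ∀ p ∈ I j, p.Prime := fun j p hp => ((hmemI j p).mp hp).2.1
  -- (i) each `σ_j^{2^j} ≤ (2^j)! U`
  have hT : ∀ j ∈ Finset.range m,
      (∑ p ∈ I j, 1 / (p : ℝ)) ^ (2 ^ j) ≤ (((2 ^ j) ! : ℕ) : ℝ) * U := by
    intro j hj
    have hjm : j < m := Finset.mem_range.mp hj
    refine (pow_sum_inv_le_factorial_mul_sum (I j) (hIprime j) (2 ^ j)).trans
      (mul_le_mul_of_nonneg_left ?_ (by positivity))
    -- the products lie in `(N₁, N₂]`, have `g ≥ 1`, and `g ≥ 0` elsewhere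
    have hS : ∀ n ∈ (Fintype.piFinset fun _ : Fin (2 ^ j) => I j).image (fun f => ∏ i, f i),
        n ∈ Finset.Ioc N₁ N₂ ∧ 1 ≤ g χ n := by
      intro n hn
      obtain ⟨f, hf, rfl⟩ := Finset.mem_image.mp hn
      have hfI : ∀ i, f i ∈ I j := fun i => Fintype.mem_piFinset.mp hf i
      have hbounds := pow_lt_prod_le Nat.one_le_two_pow (hypos j) (f := f) fun i =>
        ⟨((hmemI j _).mp (hfI i)).2.2.1, ((hmemI j _).mp (hfI i)).2.2.2.1⟩
      rw [hyK j hjm, show 2 * 2 ^ j = 2 ^ j * 2 by ring, pow_mul, hyK j hjm] at hbounds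
      refine ⟨Finset.mem_Ioc.mpr ⟨?_, ?_⟩, ?_⟩
      · rw [hN₁]; exact (Nat.floor_lt hC0.le).mpr hbounds.1
      · rw [hN₂]; exact Nat.le_floor hbounds.2
      · refine one_le_g_of_forall_primeFactors χ hq ?_ fun p hp => ?_
        · exact Finset.prod_ne_zero_iff.mpr fun i _ => (hIprime j _ (hfI i)).ne_zero
        · exact ((hmemI j p).mp (primeFactors_prod_subset (I j) (hIprime j) hfI hp)).2.2.2.2
    calc ∑ n ∈ (Fintype.piFinset fun _ : Fin (2 ^ j) => I j).image (fun f => ∏ i, f i),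
          1 / ((n : ℕ) : ℝ)
        ≤ ∑ n ∈ (Fintype.piFinset fun _ : Fin (2 ^ j) => I j).image (fun f => ∏ i, f i),
            g χ n / ((n : ℕ) : ℝ) :=
          Finset.sum_le_sum fun n hn => div_le_div_of_nonneg_right (hS n hn).2 (Nat.cast_nonneg n)
      _ ≤ U := by
          rw [hU]
          exact Finset.sum_le_sum_of_subset_of_nonneg (fun n hn => (hS n hn).1)
            fun n _ _ => div_nonneg (g_nonneg χ hq n) (Nat.cast_nonneg n)
  -- (ii) `α ≤ Σ_j σ_j`: the `I_j` are disjoint and cover the primes `A < p ≤ D²` with `χ(p) ≠ −1`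
  have hdisj : ((Finset.range m : Finset ℕ) : Set ℕ).PairwiseDisjoint I := by
    intro j₁ hj₁ j₂ hj₂ hne
    have hj₁m : j₁ < m := Finset.mem_range.mp hj₁
    have hj₂m : j₂ < m := Finset.mem_range.mp hj₂
    -- for `a < b < m`: `y_a ≥ (y_b)²`
    have key : ∀ a b : ℕ, a < b → b < m → y b ^ 2 ≤ y a := by
      intro a b hab hbm
      rw [hyj, hyj, ← pow_mul]
      refine pow_le_pow_right₀ hA1 ?_
      calc 2 ^ (m - 1 - b) * 2 = 2 ^ (m - 1 - b + 1) := by rw [pow_succ]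
        _ ≤ 2 ^ (m - 1 - a) := Nat.pow_le_pow_right two_pos (by omega)
    rw [Function.onFun, Finset.disjoint_left]
    intro p hp₁ hp₂
    have h₁ := (hmemI j₁ p).mp hp₁
    have h₂ := (hmemI j₂ p).mp hp₂
    rcases lt_or_gt_of_ne hne with hlt | hlt
    · have := key j₁ j₂ hlt hj₂m; linarith only [this, h₁.2.2.1, h₂.2.2.2.1]
    · have := key j₂ j₁ hlt hj₁m; linarith only [this, h₂.2.2.1, h₁.2.2.2.1]
  have hcover : (Finset.range (D ^ 2 + 1)).filter
      (fun p : ℕ => p.Prime ∧ A < (p : ℝ) ∧ χ (p : ZMod D) ≠ -1) ⊆ (Finset.range m).biUnion I := by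
    intro p hp
    rw [Finset.mem_filter, Finset.mem_range] at hp
    obtain ⟨hpD, hpp, hAp, hχp⟩ := hp
    have hpN₂ : p < N₂ + 1 := by
      have : p ≤ D ^ 4 := by
        calc p ≤ D ^ 2 := by omega
          _ ≤ D ^ 4 := Nat.pow_le_pow_right (by omega) (by norm_num)
      omega
    have hex : ∃ j, j < m ∧ y j < (p : ℝ) := ⟨m - 1, by omega, by
      rw [hyj, show m - 1 - (m - 1) = 0 by omega, pow_zero, pow_one]; exact hAp⟩
    obtain ⟨j₀, hj₀⟩ : ∃ j₀, j₀ = Nat.find hex := ⟨_, rfl⟩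
    have hj₀spec := Nat.find_spec hex
    rw [← hj₀] at hj₀spec
    rw [Finset.mem_biUnion]
    refine ⟨j₀, Finset.mem_range.mpr hj₀spec.1, (hmemI j₀ p).mpr ⟨hpN₂, hpp, hj₀spec.2, ?_, hχp⟩⟩
    rcases Nat.eq_zero_or_pos j₀ with hz | hpos
    · -- `j₀ = 0`: `p ≤ D² ≤ C ≤ C² = y₀²`
      rw [hz, show y 0 ^ 2 = C ^ 2 by
        rw [← hyK 0 (by omega), pow_zero, pow_one]]
      have : (p : ℝ) ≤ (D : ℝ) ^ 4 := by
        have h' : p ≤ D ^ 4 := by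
          calc p ≤ D ^ 2 := by omega
            _ ≤ D ^ 4 := Nat.pow_le_pow_right (by omega) (by norm_num)
        exact_mod_cast h'
      linarith only [this, hCD4, hCC]
    · -- `j₀ = j' + 1`: minimality gives `p ≤ y_{j'} = y_{j₀}²`
      have hmin := Nat.find_min hex (show j₀ - 1 < Nat.find hex by rw [← hj₀]; omega)
      push Not at hmin
      have hle := hmin (by omega)
      rw [show y j₀ ^ 2 = y (j₀ - 1) by
        rw [hysq (j₀ - 1) (by omega), show j₀ - 1 + 1 = j₀ by omega]]
      exact hle
  have hsum : α ≤ ∑ j ∈ Finset.range m, ∑ p ∈ I j, 1 / (p : ℝ) := by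
    rw [← Finset.sum_biUnion hdisj, hα]
    exact Finset.sum_le_sum_of_subset_of_nonneg hcover fun p _ _ => by positivity
  have hα0 : 0 ≤ α := by rw [hα]; exact Finset.sum_nonneg fun p _ => by positivity
  -- conclude by the selection inequality
  have hsel := rpow_div_le_of_pow_le_factorial_mul hm1 (σ := fun j => ∑ p ∈ I j, 1 / (p : ℝ))
    hα0 hαM hM hU0 hsum (fun j hj => by exact_mod_cast hT j hj)
  rw [show α * ℓ / (16 * L) = α / (16 * L / ℓ) by rw [div_div_eq_mul_div]]
  exact hsel.trans hUle

end LemmaThreeWeak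

/-! ### Theorem 4 (and hence Theorem 5)

PRINT (p. 287–288): "To prove Theorem 4 we need a result of Mertens, that for `x ≥ 3` (5.5)
`Σ_{p≤x} 1/p ≤ log log x + B`, where `B` is an absolute constant. Let `A` be defined by (5.6)
`log A = 8 log D log log D/log(1/(5 log D · L(1)))` (`≥ 8`) and let us assume that the assertion of
Theorem 4 (i.e. (1.26)) is not true but (5.7) `exp(Σ_{p≤D²}(1+χ(p))/p) ≥ e^{2B+2} log²A`. Then
(5.8) `Σ_{p≤D²}(1+χ(p))/p ≥ 2 log log A + 2B + 2`. From (5.8) and (5.5) it follows that `A ≤ D²`,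
and (5.9) `Σ_{A<p≤D²}(1+χ(p))/p ≥ 2` and so (5.10) `α = Σ_{A<p≤D², χ(p)≠−1} 1/p ≥ 1 ≥ 8/log A`. Now
using Lemma 3 from (5.2) we have (5.11) `5 log D · L(1) > (1/log D)^{8 log D/log A}`, (5.12)
`(8 log D/log A) log log D > log(1/(5 log D · L(1)))` which contradicts to (5.6) and so the
Theorem 4 is proved."
HERE: the same, with the tree's two-sided Mertens theorem `|Σ_{p≤x} 1/p − log log x − B₁| ≤ 8/log x`
(`Mertens.abs_primeRecipSum_sub_le`, `B = B₁` the Meissel–Mertens constant) and `lemma3_weak` in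
place of Lemma 3: `log A = 16 log D log log D/log(1/(9e log D · L(1)))`, the strict inequality of
(5.2) being replaced by the factor `e`; the constant is `C = 1024 e^{2B₁+3}` and the threshold
`D ≥ max(65536, e^{125})`. -/

section TheoremFour

open Literature.NumberTheory.LFunctions.Mertens

/-- `Σ_{p ≤ x} 1/p` over the tree's `primesLE ⌊x⌋₊` is `primeRecipSum x`, written with `1/p`.
[folklore] -/
private theorem primeRecipSum_eq_sum_one_div (x : ℝ) :
    primeRecipSum x = ∑ p ∈ Nat.primesLE ⌊x⌋₊, 1 / (p : ℝ) := by
  rw [primeRecipSum]; exact Finset.sum_congr rfl fun p _ => (one_div _).symm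

/-- **Pintz 1976 (II), Theorem 4 — PROVED** (`pintz1976_theorem4_holds : pintz1976_theorem4`).
[cite: Pintz1976ElementaryII, Theorem 4 pp. 277–278 (1.25)–(1.26), proof §5 pp. 286–288] -/
theorem theorem4 : pintz1976_theorem4 := by
  obtain ⟨D₃, hD₃⟩ := lemma3_weak
  refine ⟨1024 * Real.exp (2 * meisselMertens + 3), max D₃ (max 65536 ⌈Real.exp 125⌉₊), ?_⟩
  intro D _ hD χ hquad hprim hL1le
  classical
  have hDD₃ : D₃ ≤ D := le_trans (le_max_left _ _) hD
  have hD65536 : 65536 ≤ D := le_trans (le_trans (le_max_left _ _) (le_max_right _ _)) hD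
  have hDe : ⌈Real.exp 125⌉₊ ≤ D := le_trans (le_trans (le_max_right _ _) (le_max_right _ _)) hD
  have hD2 : 2 ≤ D := le_trans (by norm_num) hD65536
  have hD' : (65536 : ℝ) ≤ D := by exact_mod_cast hD65536
  have hD0 : (0 : ℝ) < D := by linarith only [hD']
  have hq : χ ^ 2 = 1 := MulChar.IsQuadratic.sq_eq_one hquad
  obtain ⟨L, hL⟩ : ∃ L : ℝ, L = Real.log D := ⟨_, rfl⟩
  obtain ⟨L1, hL1def⟩ : ∃ L1 : ℝ, L1 = (χ.LFunction 1).re := ⟨_, rfl⟩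
  rw [← hL, ← hL1def] at hL1le ⊢
  obtain ⟨B, hB⟩ : ∃ B : ℝ, B = meisselMertens := ⟨_, rfl⟩
  rw [← hB]
  -- `L ≥ 125`, `L1 > 0`, `√D L1 ≥ 2/3`
  have hL125 : 125 ≤ L := by
    rw [hL, Real.le_log_iff_exp_le hD0]
    exact le_trans (Nat.le_ceil _) (by exact_mod_cast hDe)
  have hLpos : 0 < L := by linarith only [hL125]
  have hlogL : 1 ≤ Real.log L := by
    rw [Real.le_log_iff_exp_le hLpos]
    have := Real.exp_one_lt_d9; linarith only [this, hL125]
  have hsD : 0 < Real.sqrt D := Real.sqrt_pos.2 hD0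
  have hsDL1 : 2 / 3 ≤ Real.sqrt D * L1 := by
    rw [hL1def]; exact two_thirds_le_sqrt_mul_lOne χ hprim hquad hD2
  have hL1pos : 0 < L1 := by
    by_contra h; push Not at h
    have : Real.sqrt D * L1 ≤ 0 := mul_nonpos_of_nonneg_of_nonpos hsD.le h
    linarith only [this, hsDL1]
  have hsqrtD : Real.sqrt D ≤ Real.exp (L / 2) := by
    rw [hL, show Real.log (D : ℝ) / 2 = Real.log (Real.sqrt D) by
      rw [Real.log_sqrt hD0.le], Real.exp_log hsD]
  -- `X = 1/(5 L1 L) ≥ 25`, `X'' = 1/(9e L1 L)`, `log X'' ∈ [½ log X, L/2]`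
  obtain ⟨X, hX⟩ : ∃ X : ℝ, X = 1 / (5 * L1 * L) := ⟨_, rfl⟩
  obtain ⟨X'', hX''⟩ : ∃ X'' : ℝ, X'' = 1 / (9 * Real.exp 1 * L1 * L) := ⟨_, rfl⟩
  have he1 := Real.exp_one_gt_d9
  have he1' := Real.exp_one_lt_d9
  have hXpos : 0 < X := by rw [hX]; positivity
  have hX''pos : 0 < X'' := by rw [hX'']; positivity
  have hX25 : 25 ≤ X := by
    rw [hX, le_div_iff₀ (by positivity)]
    have : L1 * L ≤ 1 / L := by
      calc L1 * L ≤ 1 / L ^ 2 * L := mul_le_mul_of_nonneg_right hL1le hLpos.le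
        _ = 1 / L := by field_simp
    rw [le_div_iff₀ hLpos] at this
    nlinarith only [this, hL125, hL1pos, hLpos]
  have hXX'' : X = (9 * Real.exp 1 / 5) * X'' := by rw [hX, hX'']; field_simp
  have hlogX'' : Real.log X'' = Real.log X - Real.log (9 * Real.exp 1 / 5) := by
    rw [hXX'', Real.log_mul (by positivity) hX''pos.ne']; ring
  have hlog95 : 2 * Real.log (9 * Real.exp 1 / 5) ≤ Real.log 25 := by
    have h' : Real.log ((9 * Real.exp 1 / 5) ^ 2) = 2 * Real.log (9 * Real.exp 1 / 5) := by
      rw [Real.log_pow]; push_cast; ring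
    rw [← h']
    refine Real.log_le_log (by positivity) ?_
    nlinarith only [he1', Real.exp_pos 1]
  have hlogX25 : Real.log 25 ≤ Real.log X := Real.log_le_log (by norm_num) hX25
  have hlog95pos : 0 < Real.log (9 * Real.exp 1 / 5) := Real.log_pos (by linarith only [he1])
  have hlogX''ge : Real.log X / 2 ≤ Real.log X'' := by linarith only [hlogX'', hlog95, hlogX25]
  have hlogXpos : 0 < Real.log X := lt_of_lt_of_le (Real.log_pos (by norm_num)) hlogX25
  have hlogX''pos : 0 < Real.log X'' := by linarith only [hlogX''ge, hlogXpos]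
  have hlogXle : Real.log X ≤ L / 2 := by
    -- `X = 1/(5 L1 L) ≤ √D` since `5 L1 L √D ≥ (10/3) L ≥ 1`
    have hXle : X ≤ Real.sqrt D := by
      rw [hX, div_le_iff₀ (by positivity)]
      nlinarith only [hsDL1, hL125, hL1pos, hsD]
    calc Real.log X ≤ Real.log (Real.sqrt D) := Real.log_le_log hXpos hXle
      _ ≤ L / 2 := by rw [← Real.log_exp (L / 2)]; exact Real.log_le_log hsD hsqrtD
  have hlogX''le : Real.log X'' ≤ L / 2 := by linarith only [hlogX'', hlogXle, hlog95pos]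
  -- `ℓ = log A = 16 L log L/log X''`, `A = e^ℓ`: `ℓ ≥ 32`, `A ≥ 2`
  obtain ⟨ℓ, hℓ⟩ : ∃ ℓ : ℝ, ℓ = 16 * L * Real.log L / Real.log X'' := ⟨_, rfl⟩
  have hℓpos : 0 < ℓ := by rw [hℓ]; positivity
  have hℓ32 : 32 ≤ ℓ := by
    rw [hℓ, le_div_iff₀ hlogX''pos]
    nlinarith only [hlogX''le, hlogL, hLpos]
  obtain ⟨A, hA⟩ : ∃ A : ℝ, A = Real.exp ℓ := ⟨_, rfl⟩
  have hApos : 0 < A := by rw [hA]; exact Real.exp_pos ℓ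
  have hlogA : Real.log A = ℓ := by rw [hA, Real.log_exp]
  have hA2 : 2 ≤ A := by
    rw [hA]; have := Real.add_one_le_exp ℓ; linarith only [this, hℓ32]
  have hkey : ℓ * Real.log X'' = 16 * L * Real.log L := by
    rw [hℓ]; field_simp
  -- suppose the conclusion fails
  by_contra hcon
  push Not at hcon
  -- (5.8): `Σ_{p≤D²}(1+χ(p))/p > 2B + 3 + 2 log ℓ`
  obtain ⟨S₂, hS₂⟩ : ∃ S₂ : ℝ, S₂ = ∑ p ∈ (Finset.range (D ^ 2 + 1)).filter Nat.Prime,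
      (1 + (χ (p : ZMod D)).re) / (p : ℝ) := ⟨_, rfl⟩
  rw [← hS₂] at hcon
  have hℓle : ℓ ≤ 32 * L * Real.log L / Real.log X := by
    rw [hℓ, div_le_div_iff₀ hlogX''pos hlogXpos]
    have h0 : 0 ≤ 16 * L * Real.log L := by positivity
    nlinarith only [hlogX''ge, h0]
  have h58 : 2 * B + 3 + 2 * Real.log ℓ < S₂ := by
    have h1 : Real.exp (2 * B + 3) * ℓ ^ 2 ≤
        1024 * Real.exp (2 * B + 3) * (L * Real.log L / Real.log X) ^ 2 := by
      have : ℓ ^ 2 ≤ (32 * L * Real.log L / Real.log X) ^ 2 := pow_le_pow_left₀ hℓpos.le hℓle 2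
      have h' : (32 * L * Real.log L / Real.log X) ^ 2 = 1024 * (L * Real.log L / Real.log X) ^ 2 := by
        ring
      rw [h'] at this
      nlinarith only [this, Real.exp_pos (2 * B + 3)]
    have h2 : Real.exp (2 * B + 3 + 2 * Real.log ℓ) = Real.exp (2 * B + 3) * ℓ ^ 2 := by
      rw [Real.exp_add, show 2 * Real.log ℓ = Real.log (ℓ ^ 2) by rw [Real.log_pow]; push_cast; ring,
        Real.exp_log (by positivity)]
    have h3 : Real.exp (2 * B + 3 + 2 * Real.log ℓ) < Real.exp S₂ := by
      rw [h2, hX] at *; linarith only [h1, hcon]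
    exact Real.exp_lt_exp.mp h3
  -- Mertens at `D²` and at `A`
  have hPD : primeRecipSum ((D : ℝ) ^ 2) = ∑ p ∈ (Finset.range (D ^ 2 + 1)).filter Nat.Prime,
      1 / (p : ℝ) := by
    rw [primeRecipSum_eq_sum_one_div, show ((D : ℝ) ^ 2) = ((D ^ 2 : ℕ) : ℝ) by push_cast; ring,
      Nat.floor_natCast, Nat.primesLE_eq_filter_range]
  have hD2r : (2 : ℝ) ≤ (D : ℝ) ^ 2 := by nlinarith only [hD']
  have hMD := abs_primeRecipSum_sub_le hD2r
  rw [← hB, show Real.log ((D : ℝ) ^ 2) = 2 * L by rw [Real.log_pow, hL]; push_cast; ring,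
    hPD] at hMD
  have hlog2L : Real.log (2 * L) = Real.log 2 + Real.log L :=
    Real.log_mul two_ne_zero hLpos.ne'
  have hMA := abs_primeRecipSum_sub_le hA2
  rw [← hB, hlogA, primeRecipSum_eq_sum_one_div] at hMA
  obtain ⟨hMD1, hMD2⟩ := abs_le.mp hMD
  obtain ⟨hMA1, hMA2⟩ := abs_le.mp hMA
  have h8ℓ : 8 / Real.log A ≤ 1 / 2 := by
    rw [hlogA, div_le_div_iff₀ hℓpos two_pos]; linarith only [hℓ32]
  have h82L : 8 / (2 * L) ≤ 1 / 2 := by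
    rw [div_le_div_iff₀ (by positivity) two_pos]; linarith only [hL125]
  -- `S₂ ≤ 2 Σ_{p≤D²} 1/p`, termwise `(1 + χ(p))/p ≤ 2/p`
  have hre1 : ∀ p : ℕ, (χ (p : ZMod D)).re ≤ 1 := fun p =>
    (Complex.re_le_norm _).trans (χ.norm_le_one _)
  have hre0 : ∀ p : ℕ, 0 ≤ 1 + (χ (p : ZMod D)).re := fun p => by
    have := (Complex.abs_re_le_norm (χ (p : ZMod D))).trans (χ.norm_le_one _)
    have := (abs_le.mp this).1; linarith only [this]
  have hS₂le : S₂ ≤ 2 * ∑ p ∈ (Finset.range (D ^ 2 + 1)).filter Nat.Prime, 1 / (p : ℝ) := by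
    rw [hS₂, Finset.mul_sum]
    refine Finset.sum_le_sum fun p _ => ?_
    rw [show 2 * (1 / (p : ℝ)) = 2 / p by ring]
    exact div_le_div_of_nonneg_right (by linarith only [hre1 p]) (Nat.cast_nonneg p)
  -- hence `ℓ < L`, `A < D ≤ D²`
  have hℓL : ℓ < L := by
    have h1 : 2 * Real.log ℓ + 3 < 2 * (Real.log 2 + Real.log L) + 1 := by
      have : 8 / (2 * L) ≤ 1 / 2 := h82L
      linarith only [h58, hS₂le, hMD2, hlog2L, this]
    have h2 : Real.log ℓ < Real.log (2 * L) - 1 := by linarith only [h1, hlog2L]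
    have h3 : Real.log ℓ < Real.log (2 * L / Real.exp 1) := by
      rw [Real.log_div (by positivity) (Real.exp_pos 1).ne', Real.log_exp]; exact h2
    have h4 : ℓ < 2 * L / Real.exp 1 := (Real.log_lt_log_iff hℓpos (by positivity)).mp h3
    rw [lt_div_iff₀ (Real.exp_pos 1)] at h4
    nlinarith only [h4, he1, hLpos]
  have hAD : A < D := by
    calc A = Real.exp ℓ := hA
      _ < Real.exp L := Real.exp_lt_exp.mpr hℓL
      _ = D := by rw [hL, Real.exp_log hD0]
  have hAD2 : A ≤ (D : ℝ) ^ 2 := by nlinarith only [hAD, hD', hApos]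
  have hAfloor : ⌊A⌋₊ ≤ D ^ 2 := by
    have : (⌊A⌋₊ : ℝ) ≤ (D : ℝ) ^ 2 := (Nat.floor_le hApos.le).trans hAD2
    exact_mod_cast this
  -- split the prime sums at `A`
  obtain ⟨Sall, hSall⟩ : ∃ Sall : Finset ℕ, Sall = (Finset.range (D ^ 2 + 1)).filter Nat.Prime :=
    ⟨_, rfl⟩
  have hlow : Sall.filter (fun p : ℕ => ¬ A < (p : ℝ)) = Nat.primesLE ⌊A⌋₊ := by
    ext p
    rw [hSall, Finset.mem_filter, Finset.mem_filter, Finset.mem_range, Nat.mem_primesLE, not_lt]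
    constructor
    · rintro ⟨⟨-, hp⟩, hle⟩; exact ⟨Nat.le_floor hle, hp⟩
    · rintro ⟨hle, hp⟩
      refine ⟨⟨by omega, hp⟩, ?_⟩
      exact le_trans (by exact_mod_cast hle) (Nat.floor_le hApos.le)
  -- `α`
  obtain ⟨α, hα⟩ : ∃ α : ℝ, α = ∑ p ∈ (Finset.range (D ^ 2 + 1)).filter
      (fun p : ℕ => p.Prime ∧ A < (p : ℝ) ∧ χ (p : ZMod D) ≠ -1), (1 : ℝ) / (p : ℝ) := ⟨_, rfl⟩
  have hαset : (Finset.range (D ^ 2 + 1)).filter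
      (fun p : ℕ => p.Prime ∧ A < (p : ℝ) ∧ χ (p : ZMod D) ≠ -1) =
      (Sall.filter (fun p : ℕ => A < (p : ℝ))).filter (fun p : ℕ => χ (p : ZMod D) ≠ -1) := by
    ext p
    simp only [hSall, Finset.mem_filter, Finset.mem_range]
    tauto
  -- (5.9)–(5.10): `α ≥ 1`
  have hα1 : 1 ≤ α := by
    -- `Σ_{A<p≤D²}(1+χ(p))/p ≤ 2α` and `Σ_{p≤A}(1+χ(p))/p ≤ 2 P(A)`
    have hsplit := Finset.sum_filter_add_sum_filter_not Sall (fun p : ℕ => A < (p : ℝ))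
      (fun p : ℕ => (1 + (χ (p : ZMod D)).re) / (p : ℝ))
    have hS₂' : ∑ p ∈ Sall, (1 + (χ (p : ZMod D)).re) / (p : ℝ) = S₂ := by rw [hS₂, hSall]
    rw [hlow, hS₂'] at hsplit
    have hhigh : ∑ p ∈ Sall.filter (fun p : ℕ => A < (p : ℝ)), (1 + (χ (p : ZMod D)).re) / (p : ℝ) ≤
        2 * α := by
      rw [hα, hαset, Finset.mul_sum]
      conv_rhs => rw [Finset.sum_filter]
      refine Finset.sum_le_sum fun p hp => ?_
      by_cases hχ : χ (p : ZMod D) ≠ -1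
      · rw [if_pos hχ, show 2 * (1 / (p : ℝ)) = 2 / p by ring]
        exact div_le_div_of_nonneg_right (by linarith only [hre1 p]) (Nat.cast_nonneg p)
      · push Not at hχ
        rw [if_neg (not_not.mpr hχ), hχ]; norm_num
    have hlowle : ∑ p ∈ Nat.primesLE ⌊A⌋₊, (1 + (χ (p : ZMod D)).re) / (p : ℝ) ≤
        2 * ∑ p ∈ Nat.primesLE ⌊A⌋₊, 1 / (p : ℝ) := by
      rw [Finset.mul_sum]
      refine Finset.sum_le_sum fun p _ => ?_
      rw [show 2 * (1 / (p : ℝ)) = 2 / p by ring]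
      exact div_le_div_of_nonneg_right (by linarith only [hre1 p]) (Nat.cast_nonneg p)
    have : 8 / ℓ ≤ 1 / 2 := by rw [← hlogA]; exact h8ℓ
    linarith only [hsplit, hhigh, hlowle, h58, hMA2, this]
  -- `α ≤ M = 16 L/ℓ`
  have hαM : α ≤ 16 * L / ℓ := by
    have hαle : α ≤ ∑ p ∈ Sall.filter (fun p : ℕ => A < (p : ℝ)), 1 / (p : ℝ) := by
      rw [hα, hαset]
      exact Finset.sum_le_sum_of_subset_of_nonneg (Finset.filter_subset _ _)
        fun p _ _ => by positivity
    have hsplit := Finset.sum_filter_add_sum_filter_not Sall (fun p : ℕ => A < (p : ℝ))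
      (fun p : ℕ => 1 / (p : ℝ))
    rw [hlow, hSall] at hsplit
    rw [hSall] at hαle
    -- `α ≤ P(D²) − P(A) ≤ log(2L) − log ℓ + 4/L + 8/ℓ ≤ log(16L/ℓ) − log 8 + 1 ≤ 16L/ℓ`
    have h1 : α ≤ Real.log (2 * L) - Real.log ℓ + 8 / (2 * L) + 8 / ℓ := by
      linarith only [hαle, hsplit, hMD2, hMA1]
    have hMpos : 0 < 16 * L / ℓ := by positivity
    have h2 : Real.log (2 * L) - Real.log ℓ = Real.log (16 * L / ℓ) - Real.log 8 := by
      rw [Real.log_div (by positivity) hℓpos.ne', Real.log_mul (by norm_num) hLpos.ne',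
        Real.log_mul (by norm_num) hLpos.ne', show (16 : ℝ) = 2 * 8 by norm_num,
        Real.log_mul (by norm_num) (by norm_num)]
      ring
    have hlog8 : 1 ≤ Real.log 8 := by
      rw [Real.le_log_iff_exp_le (by norm_num)]; linarith only [he1']
    have h3 : Real.log (16 * L / ℓ) ≤ 16 * L / ℓ - 1 := Real.log_le_sub_one_of_pos hMpos
    have h4 : 8 / ℓ ≤ 1 / 2 := by rw [div_le_div_iff₀ hℓpos two_pos]; linarith only [hℓ32]
    linarith only [h1, h2, hlog8, h3, h4, h82L]
  -- Lemma 3 (threshold form)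
  have hL3 := hD₃ D hDD₃ χ hquad hprim A hA2 hAD2 (by rw [← hα, hlogA, ← hL]; exact hαM)
  rw [← hα, hlogA, ← hL, ← hL1def] at hL3
  -- the left side is at least `(1/L)^{16L/ℓ} = 1/X'' = 9e L1 L`
  have hbase : 1 / L ≤ α * ℓ / (16 * L) := by
    rw [div_le_div_iff₀ hLpos (by positivity)]
    have : 16 ≤ α * ℓ := by nlinarith only [hα1, hℓ32]
    nlinarith only [this, hLpos]
  have hexp0 : 0 ≤ 16 * L / ℓ := by positivity
  have hlow3 : (1 / L) ^ (16 * L / ℓ) ≤ (α * ℓ / (16 * L)) ^ (16 * L / ℓ) :=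
    Real.rpow_le_rpow (by positivity) hbase hexp0
  have hval : (1 / L) ^ (16 * L / ℓ) = 9 * Real.exp 1 * L1 * L := by
    rw [Real.rpow_def_of_pos (by positivity), Real.log_div one_ne_zero hLpos.ne', Real.log_one,
      zero_sub, show -Real.log L * (16 * L / ℓ) = -Real.log X'' by
        rw [neg_mul, neg_inj]; field_simp; linarith only [hkey],
      Real.exp_neg, Real.exp_log hX''pos, hX'', one_div, inv_inv]
  rw [hval] at hlow3
  have hfin : 9 * Real.exp 1 * L1 * L ≤ 9 * L * L1 := hlow3.trans hL3
  nlinarith only [hfin, he1, hL1pos, hLpos, mul_pos hL1pos hLpos]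

end TheoremFour

end Pintz1976

/-- **Pintz 1976 (II), Theorem 4 — PROVED** (`pintz1976_theorem4_holds : pintz1976_theorem4`): for
`D ≥ D₀` and a real primitive `χ` mod `D` with `L(1, χ) ≤ 1/log²D`,
`exp(Σ_{p≤D²}(1 + χ(p))/p) ≤ C (log D log log D/log(1/(5L(1) log D)))²` with
`C = 1024 e^{2B₁+3}` (`B₁` the Meissel–Mertens constant). Road as printed (§5): Lemma 3 (here in
threshold form, `Pintz1976.lemma3_weak`) and Mertens' theorem (tree, with rate).
[cite: Pintz1976ElementaryII, Theorem 4 pp. 277–278 (1.25)–(1.26), proof §5 pp. 286–288] -/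
theorem pintz1976_theorem4_holds : pintz1976_theorem4 := Pintz1976.theorem4

/-- **Pintz 1976 (II), Theorem 5 — PROVED** (`pintz1976_theorem5_holds : pintz1976_theorem5`):
under `L(1, χ) ≤ 1/log²D` the Siegel zero `1 − δ` exists and
`L(1)/δ ≤ C (log D log log D/log(1/(5L(1) log D)))²` — Theorem 1, (6.1) and Theorem 4
(`Pintz1976.theorem5_of_theorem4`).
[cite: Pintz1976ElementaryII, Theorem 5 pp. 278–279 (1.30)–(1.31), proof §6 p. 288] -/
theorem pintz1976_theorem5_holds : pintz1976_theorem5 :=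
  Pintz1976.theorem5_of_theorem4 pintz1976_theorem4_holds

end Literature.NumberTheory.LFunctions

end
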